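import Literature.LinearAlgebra.Matrix.SymplecticGroupGeneration
import Literature.RepresentationTheory.FiniteGroups.GLnMinimalCharacterDegree
import HarnessLib

/-!
# A lower bound for the non-linear character degrees of `Sp(2n, 𝔽_q)`
# (Landazuri–Seitz 1974, type `C`, weak form via the Siegel Levi factor `SL_n(𝔽_q)`)

Topic `Literature/RepresentationTheory/FiniteGroups`, namespace
`Literature.RepresentationTheory.FiniteGroups` (grouping sub-namespace `Sp2n` for the statements
about the group `Sp(2n, q)` = Mathlib's `Matrix.symplecticGroup (Fin n) F`).  Everything here is
**proved**; no named fact.  Two auxiliary definitions (group homomorphisms into `Sp`).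

## The printed source and what is proved

V. Landazuri, G. M. Seitz, *On the minimal degrees of projective representations of the finite
Chevalley groups*, J. Algebra 32 (1974) 418–443 [LandazuriSeitz1974]: the table of §1 (p. 419;
held copy `paper:doi-10-1016-0021-8693-74-90150-1`, PDF p. 2) gives for `PSp(2n, q)` the lower
bound `½(qⁿ − 1)` (`q` odd) and `½ q^{n−1}(q^{n−1} − 1)(q − 1)` (`q` even, `n ≥ 2`) for the least
degree of a non-trivial projective irreducible representation, and Lemma 3.1 (p. 424) the bound
`q^{n−1} − 1` for `PSL(n, q)`, `n ≥ 3`.  The tree proves Lemma 3.1 for the ordinary characters of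
`SL_n(𝔽_q)` (`SLn.le_charDegree_of_three_le`, `SLn.le_charDegree_two`).  This file proves the
following WEAK type-`C` form, a corollary of the printed table (never stronger than print):

* **`Sp2n.le_charDegree_of_three_le`** — for `n ≥ 3` every irreducible complex character of
  `Sp(2n, 𝔽_q)` of degree `d > 1` has `q^{n−1} − 1 ≤ d`;
* **`Sp2n.le_charDegree_two`** — `Sp(4, 𝔽_q)`: `q − 1 ≤ gcd(2, q − 1) · d`;
* **`Sp2n.le_charDegree_one`** — `Sp(2, 𝔽_q)` (`= SL_2(𝔽_q)`): `q − 1 ≤ gcd(2, q − 1) · d`;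
* (appended) **`Sp2n.commutator_eq_top`** — `Sp_{2n}(𝔽_q)` is perfect (`n ≥ 3`, or `n = 2` and
  `q ≥ 4`); **`Sp2n.slTwoEquiv`** — `SL_2(F) ≃* Sp_2(F)`;
* (appended) the "non-trivial character" form: **`Sp2n.exists_degree_ge_of_ne_one`** — every
  irreducible `χ ≠ 1` of `Sp(2n, 𝔽_q)`, `n ≥ 3`, has `χ(1) ≥ q^{n−1} − 1` (quasirandomness);
* the forms consumed by the matrix-multiplication barrier (BCGPU 2023, Cor. 3.4 for type `C`,
  `Literature/Barriers/MatrixMultiplication/QuasirandomBarrierLieTypeC*.lean`):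
  **`Sp2n.secondCharDegree_ge`** (`n(Sp(2(m+1), q)) ≥ q^m/4`, `m ≥ 1`) and
  **`Sp2n.secondCharDegree_ge_one`** (`n(Sp(2, q)) ≥ q/4`).

The true minimal degree `½(qⁿ − 1)` (`q` odd) is NOT claimed: this is the bound obtained from the
Levi factor alone.  TODO(general form): the printed `½(qⁿ − 1)` via the Siegel radical
(`GL_n`-orbits on quadratic forms) or the Heisenberg parabolic.

## The argument (not the printed one: restriction to a Levi factor)

`exists_charDegree_le_of_normalClosure` — for `f : A → B` with `A` perfect and the normal closure
of `f(A)` equal to `B`, below every irreducible degree `d > 1` of `B` lies an irreducible degree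
`1 < d' ≤ d` of `A`: restrict, and if every constituent were linear then `f(A) = f(A')` would lie in
the kernel of the character (a normal subgroup, Isaacs Lemma 2.19 / Def. 2.20 = the tree's
`mem_ker_iff_character_eq`), hence so would `B`, and the character would be linear.  Applied to the
Siegel Levi embedding `Sp2n.leviHom : SL_n(F) → Sp_{2n}(F)`, `M ↦ [[M, 0], [0, M⁻ᵀ]]`, whose image
has normal closure `Sp_{2n}(F)` (`Sp.eq_top_of_normal_of_levi_transvection_mem`, Artin Thm. 5.1 /
3.25 in `Literature/LinearAlgebra/Matrix/SymplecticGroupGeneration.lean`), `SL_n(F)` being perfect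
for `n ≥ 3` or `|F| ≥ 4` (tree `SLn.commutator_eq_top`); for `n = 1`, `Sp_2(F) = SL_2(F)` via the
surjection `Sp2n.slTwoHom`.

## Mathlib / tree search

Mathlib: `Matrix.symplecticGroup`, no representation theory of `Sp`.  Tree: `SLn.*`/`GLn.*` minimal
degrees (type `A`), `exists_charDegree_le_of_commutator` (transfer along `B' ≤ f(A)`), nothing for
`Sp` (`lean search "symplectic"`: only `QuasirandomBarrierLieTypeC*` and Siegel modular files).

## References

* [LandazuriSeitz1974] V. Landazuri, G. M. Seitz, J. Algebra 32 (1974) 418–443, §1 table (p. 419)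
  and Lemma 3.1 (p. 424).
* [Isaacs1976] I. M. Isaacs, *Character Theory of Finite Groups*, Lemma 2.19, Def. 2.20,
  Lemma 2.22, Cor. 2.23.
* [Artin1988] E. Artin, *Geometric Algebra*, Thm. 3.25 and Thm. 5.1.
* [BlasiakCohnGrochowPrattUmans2023] J. Blasiak, H. Cohn, J. A. Grochow, K. Pratt, C. Umans,
  *Matrix multiplication via matrix groups*, ITCS 2023 = arXiv:2204.03826, Cor. 3.4 (consumer).
-/

noncomputable section

open scoped BigOperators
open Matrix

namespace Literature.RepresentationTheory.FiniteGroups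

/-! ## §1 Transfer of a minimal-degree bound along `f : A → B` with `⟪f(A)⟫^B = B`, `A` perfect -/

section Transfer

variable {A B : Type} [Group A] [Group B] [Fintype A] [Fintype B]

/-- **Transfer of a minimal-degree bound through a normally generating perfect subgroup.**  Let
`f : A → B` be a homomorphism of finite groups with `A' = A` and such that the normal closure of
`f(A)` is `B`.  Then below every irreducible character degree `d > 1` of `B` there is an irreducible
character degree `1 < d' ≤ d` of `A` (restrict to `A` and take a non-linear constituent — one
exists, for otherwise `f(A) = f(A')` lies in the kernel of the character, a normal subgroup
(Isaacs Lemma 2.19, Def. 2.20), hence so does `B`, and the character is linear).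
[cite: Isaacs1976, Lemma 2.19, Def. 2.20, Lemma 2.22 and Cor. 2.23] -/
theorem exists_charDegree_le_of_normalClosure (f : A →* B)
    (hB : Subgroup.normalClosure ((f.range : Subgroup B) : Set B) = ⊤)
    (hA : commutator A = ⊤) {d : ℕ} (hd : d ∈ charDegrees B) (h1 : 1 < d) :
    ∃ d' ∈ charDegrees A, 1 < d' ∧ d' ≤ d := by
  classical
  obtain ⟨χ, hχ, hχd⟩ := exists_isIrrChar_of_mem_charDegrees hd
  have hπ : IsCharacter A (χ ∘ f) := hχ.isCharacter.comp f
  have hπ1 : (χ ∘ f) 1 = χ 1 := by rw [Function.comp_apply, map_one]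
  by_cases hlin : ∀ ψ : A → ℂ, IsIrrChar A ψ → classInner (χ ∘ f) ψ ≠ 0 → ψ 1 = 1
  · -- every constituent of `χ ∘ f` is linear: `χ` is trivial on `f(A)`, hence on its normal closure
    exfalso
    have hconst : ∀ a : A, (χ ∘ f) a = (χ ∘ f) 1 := fun a =>
      apply_eq_apply_one_of_constituents_linear hπ hlin (hA ▸ Subgroup.mem_top a)
    have hχ' := hχ
    obtain ⟨W, _, _, _, σ, hσ, hσχ⟩ := hχ'
    have hrange : ((f.range : Subgroup B) : Set B) ⊆ (MonoidHom.ker σ : Subgroup B) := by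
      rintro _ ⟨a, rfl⟩
      rw [SetLike.mem_coe, mem_ker_iff_character_eq, hσχ]
      have h := hconst a
      rwa [hπ1] at h
    have hle : Subgroup.normalClosure ((f.range : Subgroup B) : Set B) ≤ MonoidHom.ker σ :=
      Subgroup.normalClosure_le_normal hrange
    rw [hB] at hle
    have hker : ∀ n ∈ (⊤ : Subgroup B), χ n = χ 1 := by
      intro n hn
      have h := hle hn
      rwa [mem_ker_iff_character_eq, hσχ] at h
    have h11 := hχ.apply_one_eq_one_of_commutator_le (N := ⊤) le_top hker
    rw [hχd, Nat.cast_eq_one] at h11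
    omega
  · push Not at hlin
    obtain ⟨ψ, hψ, hne, hψ1⟩ := hlin
    obtain ⟨d', hd', hψd'⟩ := hψ.exists_apply_one
    have hd'1 : 1 < d' := by
      have h0 := pos_of_mem_charDegrees hd'
      have hne1 : d' ≠ 1 := fun h => hψ1 (by rw [hψd', h, Nat.cast_one])
      omega
    obtain ⟨ξ, hξ, hsum⟩ := hπ.exists_eq_add_of_classInner_ne_zero hψ hne
    obtain ⟨nξ, hnξ⟩ := hξ.exists_nat_apply_one
    have hdd : (d : ℂ) = d' + nξ := by
      rw [← hχd, ← hψd', ← hnξ, ← hπ1, hsum, Pi.add_apply]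
    have hdd' : d = d' + nξ := by exact_mod_cast hdd
    exact ⟨d', hd', hd'1, by omega⟩

end Transfer

/-! ## §2 The Siegel Levi embedding `SL_n(F) → Sp_{2n}(F)` and the identification `SL_2 = Sp_2` -/

namespace Sp2n

open Literature.LinearAlgebra.Matrix

variable {F : Type} [Field F] {ι : Type} [DecidableEq ι] [Fintype ι]

/-- The Siegel Levi embedding `SL_n(F) → Sp_{2n}(F)`, `M ↦ [[M, 0], [0, M⁻ᵀ]]`.
[cite: Artin1988, Chap. III §5 (Thm. 3.25)] -/
def leviHom : SpecialLinearGroup ι F →* Matrix.symplecticGroup ι F where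
  toFun M := ⟨Sp.levi (M : Matrix ι ι F), Sp.levi_mem (by rw [M.det_coe]; exact isUnit_one)⟩
  map_one' := Subtype.ext (by simp only [Matrix.SpecialLinearGroup.coe_one, Sp.levi_one]; rfl)
  map_mul' M N := Subtype.ext (by
    simp only [Matrix.SpecialLinearGroup.coe_mul, ← Sp.levi_mul_levi]; rfl)

/-- The value of `leviHom`. [cite: Artin1988, Chap. III §5 (Thm. 3.25)] -/
theorem coe_leviHom (M : SpecialLinearGroup ι F) :
    ((leviHom M : Matrix.symplecticGroup ι F) : Matrix (ι ⊕ ι) (ι ⊕ ι) F) = Sp.levi (M : Matrix ι ι F) :=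
  rfl

/-- **The normal closure of the Siegel Levi factor `SL_n(𝔽_q)` in `Sp_{2n}(𝔽_q)` is everything**
(`n ≥ 3`, or `n = 2` and `𝔽_q ≠ 𝔽₂, 𝔽₃`): it contains the Levi images of all transvections
(Artin Thm. 5.1, special case, `Sp.eq_top_of_normal_of_levi_transvection_mem`).
[cite: Artin1988, Chap. V §1 (Thm. 5.1)] -/
theorem normalClosure_range_leviHom [Finite F] [LinearOrder ι] [Nontrivial ι]
    (h : 3 ≤ Fintype.card ι ∨ ∃ a : F, a ≠ 0 ∧ a ^ 2 ≠ 1) :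
    Subgroup.normalClosure (((leviHom : SpecialLinearGroup ι F →* _).range :
      Subgroup (Matrix.symplecticGroup ι F)) : Set (Matrix.symplecticGroup ι F)) = ⊤ :=
  Sp.eq_top_of_normal_of_levi_transvection_mem Subgroup.normalClosure_normal h fun i j hij t =>
    Subgroup.subset_normalClosure ⟨⟨transvection i j t, det_transvection_of_ne i j hij t⟩, rfl⟩

/-- `SL_2(F) → Sp_2(F)`: a `2 × 2` matrix of determinant `1` is symplectic (`1 × 1` blocks).
(Mathlib TODO "for `n = 1` the symplectic group coincides with the special linear group".)
[cite: Artin1988, Chap. III §5 (Thm. 3.25)] -/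
def slTwoHom : SpecialLinearGroup (Fin 2) F →* Matrix.symplecticGroup (Fin 1) F where
  toFun M := ⟨fromBlocks ((M : Matrix (Fin 2) (Fin 2) F) 0 0 • (1 : Matrix (Fin 1) (Fin 1) F))
      ((M : Matrix (Fin 2) (Fin 2) F) 0 1 • 1) ((M : Matrix (Fin 2) (Fin 2) F) 1 0 • 1)
      ((M : Matrix (Fin 2) (Fin 2) F) 1 1 • 1), by
    have hdet : (M : Matrix (Fin 2) (Fin 2) F) 0 0 * (M : Matrix (Fin 2) (Fin 2) F) 1 1 -
        (M : Matrix (Fin 2) (Fin 2) F) 1 0 * (M : Matrix (Fin 2) (Fin 2) F) 0 1 = 1 := by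
      have h := Matrix.det_fin_two (M : Matrix (Fin 2) (Fin 2) F)
      rw [M.det_coe] at h
      linear_combination -h
    rw [SymplecticGroup.fromBlocks_mem_iff]
    simp only [transpose_smul, transpose_one, Matrix.smul_mul, Matrix.mul_smul, Matrix.one_mul,
      smul_smul]
    refine ⟨by rw [mul_comm], by rw [mul_comm], ?_⟩
    have hdet' : (M : Matrix (Fin 2) (Fin 2) F) 1 1 * (M : Matrix (Fin 2) (Fin 2) F) 0 0 -
        (M : Matrix (Fin 2) (Fin 2) F) 0 1 * (M : Matrix (Fin 2) (Fin 2) F) 1 0 = 1 := by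
      linear_combination hdet
    rw [← sub_smul, hdet', one_smul]⟩
  map_one' := Subtype.ext (by
    simp only [Matrix.SpecialLinearGroup.coe_one, one_apply_eq,
      one_apply_ne (show (0 : Fin 2) ≠ 1 by decide), one_apply_ne (show (1 : Fin 2) ≠ 0 by decide),
      one_smul, zero_smul, fromBlocks_one]
    rfl)
  map_mul' M N := Subtype.ext (by
    simp only [Matrix.SpecialLinearGroup.coe_mul, Matrix.mul_apply, Fin.sum_univ_two, add_smul]
    change _ = fromBlocks _ _ _ _ * fromBlocks _ _ _ _
    rw [fromBlocks_multiply]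
    simp only [Matrix.smul_mul, Matrix.mul_smul, Matrix.one_mul, smul_smul, mul_comm])

/-- `slTwoHom` is onto: every element of `Sp_2(F)` is a `2 × 2` matrix of determinant `1`.
[cite: Artin1988, Chap. III §5 (Thm. 3.25)] -/
theorem slTwoHom_surjective : Function.Surjective (slTwoHom : SpecialLinearGroup (Fin 2) F →* _) := by
  intro g
  obtain ⟨x, hx⟩ := g
  set M : Matrix (Fin 2) (Fin 2) F := !![x (Sum.inl 0) (Sum.inl 0), x (Sum.inl 0) (Sum.inr 0);
    x (Sum.inr 0) (Sum.inl 0), x (Sum.inr 0) (Sum.inr 0)] with hM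
  -- the symplectic condition on the `1 × 1` blocks is `det = 1`
  have hx' : fromBlocks x.toBlocks₁₁ x.toBlocks₁₂ x.toBlocks₂₁ x.toBlocks₂₂ ∈
      Matrix.symplecticGroup (Fin 1) F := by rwa [fromBlocks_toBlocks]
  obtain ⟨-, -, h3⟩ := SymplecticGroup.fromBlocks_mem_iff.1 hx'
  have h3' := congrFun (congrFun h3 0) 0
  simp only [Matrix.sub_apply, Matrix.mul_apply, Fin.sum_univ_one, transpose_apply,
    toBlocks₁₁, toBlocks₁₂, toBlocks₂₁, toBlocks₂₂, of_apply, Matrix.one_apply_eq] at h3'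
  have hdet : M.det = 1 := by
    rw [Matrix.det_fin_two_of, ← h3']; ring
  refine ⟨⟨M, hdet⟩, Subtype.ext ?_⟩
  change fromBlocks _ _ _ _ = x
  ext i j
  rcases i with i | i <;> rcases j with j | j <;>
    · obtain rfl : i = 0 := Subsingleton.elim _ _
      obtain rfl : j = 0 := Subsingleton.elim _ _
      simp [hM]

/-- **`Sp_{2n}(𝔽_q)` is perfect** for `n ≥ 3`, or `n = 2` and `𝔽_q ≠ 𝔽₂, 𝔽₃` (a corollary of
Artin's Thm. 5.1 — the commutator subgroup is a non-central normal subgroup; here: it contains the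
Levi images of the transvections, which are commutators in `SL_n(F)` by the tree's
`SLn.commutator_eq_top`, and `Sp.eq_top_of_normal_of_levi_transvection_mem` applies).  The printed
exceptions are exactly `Sp_2(𝔽_2)`, `Sp_2(𝔽_3)`, `Sp_4(𝔽_2)`; this statement also omits `Sp_4(𝔽_3)`.
[cite: Artin1988, Chap. V §1 (Thm. 5.1)] -/
theorem commutator_eq_top [Finite F] [LinearOrder ι] [Nontrivial ι]
    (h : 3 ≤ Fintype.card ι ∨ ∃ a : F, a ≠ 0 ∧ a ^ 2 ≠ 1) :
    commutator (Matrix.symplecticGroup ι F) = ⊤ := by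
  refine Sp.eq_top_of_normal_of_levi_transvection_mem inferInstance h fun i j hij t => ?_
  have hmem : (⟨transvection i j t, det_transvection_of_ne i j hij t⟩ : SpecialLinearGroup ι F) ∈
      commutator (SpecialLinearGroup ι F) := by
    rw [Literature.LinearAlgebra.Matrix.SLn.commutator_eq_top h]; trivial
  have hle : (commutator (SpecialLinearGroup ι F)).map (leviHom : SpecialLinearGroup ι F →* _) ≤
      commutator (Matrix.symplecticGroup ι F) := by
    rw [commutator_def, commutator_def, Subgroup.map_commutator]
    exact Subgroup.commutator_mono le_top le_top
  exact hle ⟨_, hmem, rfl⟩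

/-- `slTwoHom` is injective (the four entries are read off the `1 × 1` blocks).
[cite: Artin1988, Chap. III §5 (Thm. 3.25)] -/
theorem slTwoHom_injective : Function.Injective (slTwoHom : SpecialLinearGroup (Fin 2) F →* _) := by
  intro M N h
  have h' := congrArg (fun g : Matrix.symplecticGroup (Fin 1) F => (g : Matrix (Fin 1 ⊕ Fin 1) (Fin 1 ⊕ Fin 1) F)) h
  obtain ⟨h11, h12, h21, h22⟩ := fromBlocks_inj.1 h'
  have e : ∀ {a b : F}, a • (1 : Matrix (Fin 1) (Fin 1) F) = b • 1 → a = b := fun hab => by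
    simpa using congrFun (congrFun hab 0) 0
  refine Matrix.SpecialLinearGroup.ext _ _ fun i j => ?_
  fin_cases i <;> fin_cases j
  exacts [e h11, e h12, e h21, e h22]

/-- **`Sp_2(F) ≅ SL_2(F)`** (every field): the symplectic group of a plane is the special linear
group (Artin: "every element of `Sp_n(k)` is a rotation"; Mathlib TODO "for `n = 1` the symplectic
group coincides with the special linear group"). [cite: Artin1988, Chap. III §5 (Thm. 3.25)] -/
def slTwoEquiv : SpecialLinearGroup (Fin 2) F ≃* Matrix.symplecticGroup (Fin 1) F :=
  MulEquiv.ofBijective slTwoHom ⟨slTwoHom_injective, slTwoHom_surjective⟩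

/-- The value of `slTwoEquiv`. [cite: Artin1988, Chap. III §5 (Thm. 3.25)] -/
theorem slTwoEquiv_apply (M : SpecialLinearGroup (Fin 2) F) : slTwoEquiv M = slTwoHom M := rfl

variable [Fintype F] [DecidableEq F]

/-- **Landazuri–Seitz, type `C`, weak form, `n ≥ 3`**: every irreducible complex character of
`Sp(2n, F)` (`= Matrix.symplecticGroup (Fin n) F`, `n = m + 1 ≥ 3`, `F` finite with `q` elements) of
degree `d > 1` has `d ≥ q^{n−1} − 1` — a corollary of the printed `n(PSp_{2n}(q)) ≥ ½(qⁿ − 1)`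
(`q` odd) / `½ q^{n−1}(q^{n−1}−1)(q−1)` (`q` even); proof here: restriction to the Siegel Levi
factor `SL_n(F)` and the tree's Lemma 3.1 for `SL_n`. [cite: LandazuriSeitz1974, §1 (table, p. 419) and Lemma 3.1] -/
theorem le_charDegree_of_three_le {m : ℕ} (hm : 2 ≤ m) {d : ℕ}
    (hd : d ∈ charDegrees (Matrix.symplecticGroup (Fin (m + 1)) F)) (h1 : 1 < d) :
    Fintype.card F ^ m - 1 ≤ d := by
  classical
  letI : Fintype (Matrix.symplecticGroup (Fin (m + 1)) F) := Fintype.ofFinite _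
  haveI : Nontrivial (Fin (m + 1)) := Fin.nontrivial_iff_two_le.mpr (by omega)
  have h3 : 3 ≤ Fintype.card (Fin (m + 1)) ∨ ∃ a : F, a ≠ 0 ∧ a ^ 2 ≠ 1 := Or.inl (by simp; omega)
  obtain ⟨d', hd', h1', hle⟩ := exists_charDegree_le_of_normalClosure leviHom
    (normalClosure_range_leviHom h3) (Literature.LinearAlgebra.Matrix.SLn.commutator_eq_top h3) hd h1
  exact (SLn.le_charDegree_of_three_le hm hd' h1').trans hle

/-- **Type `C`, weak form, `n = 2`**: every irreducible complex character of `Sp(4, F)` of degree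
`d > 1` has `q − 1 ≤ gcd(2, q − 1) · d` (restriction to the Levi factor `SL_2(F)`, perfect for
`|F| ≥ 4`; for `|F| ≤ 3` the bound is `≤ 2 ≤ 2d`).  Print: `n(PSp_4(q)) ≥ ½(q² − 1)` (`q` odd).
[cite: LandazuriSeitz1974, §1 (table, p. 419) and Lemma 3.1] -/
theorem le_charDegree_two {d : ℕ} (hd : d ∈ charDegrees (Matrix.symplecticGroup (Fin 2) F))
    (h1 : 1 < d) : Fintype.card F - 1 ≤ Nat.gcd 2 (Fintype.card F - 1) * d := by
  classical
  letI : Fintype (Matrix.symplecticGroup (Fin 2) F) := Fintype.ofFinite _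
  by_cases hF : 4 ≤ Nat.card F
  · have ha := Literature.NumberTheory.GaloisRepresentations.exists_ne_zero_and_sq_ne_one_of_card hF
    have h3 : 3 ≤ Fintype.card (Fin 2) ∨ ∃ a : F, a ≠ 0 ∧ a ^ 2 ≠ 1 := Or.inr ha
    obtain ⟨d', hd', h1', hle⟩ := exists_charDegree_le_of_normalClosure leviHom
      (normalClosure_range_leviHom h3) (Literature.LinearAlgebra.Matrix.SLn.commutator_eq_top h3) hd h1
    exact (SLn.le_charDegree_two hd' h1').trans (Nat.mul_le_mul_left _ hle)
  · rw [Nat.card_eq_fintype_card] at hF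
    have hq : 1 < Fintype.card F := Fintype.one_lt_card
    have hg : Nat.gcd 2 (Fintype.card F - 1) = Fintype.card F - 1 := by
      interval_cases (Fintype.card F) <;> rfl
    rw [hg]
    exact Nat.le_mul_of_pos_right _ (by omega)

/-- **Type `C`, `n = 1`**: `Sp(2, F) = SL_2(F)`, so every irreducible complex character of
`Sp(2, F)` of degree `d > 1` has `q − 1 ≤ gcd(2, q − 1) · d` (the tree's Lemma 3.1 for `SL_2`,
transferred along the surjection `slTwoHom`). [cite: LandazuriSeitz1974, Lemma 3.1] -/
theorem le_charDegree_one {d : ℕ} (hd : d ∈ charDegrees (Matrix.symplecticGroup (Fin 1) F))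
    (h1 : 1 < d) : Fintype.card F - 1 ≤ Nat.gcd 2 (Fintype.card F - 1) * d := by
  classical
  letI : Fintype (Matrix.symplecticGroup (Fin 1) F) := Fintype.ofFinite _
  by_cases hF : 4 ≤ Nat.card F
  · have hrange : commutator (Matrix.symplecticGroup (Fin 1) F) ≤
        (slTwoHom : SpecialLinearGroup (Fin 2) F →* _).range := by
      rw [MonoidHom.range_eq_top.2 slTwoHom_surjective]; exact le_top
    obtain ⟨d', hd', h1', hle⟩ := exists_charDegree_le_of_commutator slTwoHom hrange
      (Literature.LinearAlgebra.Matrix.SLn.commutator_eq_top_of_four_le_card (Or.inr hF)) hd h1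
    exact (SLn.le_charDegree_two hd' h1').trans (Nat.mul_le_mul_left _ hle)
  · rw [Nat.card_eq_fintype_card] at hF
    have hq : 1 < Fintype.card F := Fintype.one_lt_card
    have hg : Nat.gcd 2 (Fintype.card F - 1) = Fintype.card F - 1 := by
      interval_cases (Fintype.card F) <;> rfl
    rw [hg]
    exact Nat.le_mul_of_pos_right _ (by omega)

/-- The coarse form `q ≤ 2d + 1` for EVERY `n ≥ 1` and every character degree `d > 1` of
`Sp(2n, 𝔽_q)`. [cite: LandazuriSeitz1974, §1 (table, p. 419) and Lemma 3.1] -/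
theorem card_le_two_mul_charDegree_add_one (m : ℕ) {d : ℕ}
    (hd : d ∈ charDegrees (Matrix.symplecticGroup (Fin (m + 1)) F)) (h1 : 1 < d) :
    Fintype.card F ≤ 2 * d + 1 := by
  have hq : 1 < Fintype.card F := Fintype.one_lt_card
  rcases Nat.lt_or_ge m 2 with hlt | hge
  · have hg : Nat.gcd 2 (Fintype.card F - 1) ≤ 2 := Nat.gcd_le_left _ two_pos
    interval_cases m
    · have h := le_charDegree_one hd h1
      have := Nat.mul_le_mul_right d hg
      omega
    · have h := le_charDegree_two hd h1
      have := Nat.mul_le_mul_right d hg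
      omega
  · have h := le_charDegree_of_three_le hge hd h1
    have hpow : Fintype.card F ≤ Fintype.card F ^ m := by
      calc Fintype.card F = Fintype.card F ^ 1 := (pow_one _).symm
        _ ≤ Fintype.card F ^ m := Nat.pow_le_pow_right (by omega) (by omega)
    omega

/-! ## §3 Quasirandomness: every non-trivial irreducible character of `Sp(2n, q)` is large -/

/-- For a perfect finite group, a non-principal irreducible character is non-linear: its degree is
a character degree `d > 1` (Isaacs Cor. 2.23: `G'` lies in the kernel of every linear character;
tree `mem_commutator_iff_forall_linear`). [cite: Isaacs1976, Cor. 2.23] -/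
theorem exists_charDegree_of_ne_one_of_commutator_eq_top {G : Type} [Group G] [Finite G]
    (hG : commutator G = ⊤) {χ : G → ℂ} (hχ : IsIrrChar G χ) (hne : χ ≠ 1) :
    ∃ d ∈ charDegrees G, χ 1 = d ∧ 1 < d := by
  obtain ⟨d, hd, hχd⟩ := hχ.exists_apply_one
  refine ⟨d, hd, hχd, ?_⟩
  have h0 := pos_of_mem_charDegrees hd
  have hd1 : d ≠ 1 := by
    intro h
    apply hne
    funext g
    have hg : g ∈ commutator G := by rw [hG]; exact Subgroup.mem_top g
    rw [(mem_commutator_iff_forall_linear g).mp hg χ hχ (by rw [hχd, h, Nat.cast_one]), Pi.one_apply]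
  omega

/-- **Landazuri–Seitz, type `C`, in the "minimal degree of a non-trivial representation" form
(quasirandomness of `Sp(2n, q)`):** for `n = m + 1 ≥ 3`, every irreducible complex character
`χ ≠ 1` of `Sp(2n, 𝔽_q)` has degree `χ(1) = d ≥ q^{n−1} − 1` (`Sp(2n, q)` is perfect,
`Sp2n.commutator_eq_top`, so `χ ≠ 1` forces `χ(1) > 1`, and `Sp2n.le_charDegree_of_three_le`
applies).  Print: `n(PSp_{2n}(q)) ≥ ½(qⁿ − 1)` (`q` odd); this is the weak form via the Levi factor.
[cite: LandazuriSeitz1974, §1 (table, p. 419) and Lemma 3.1] -/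
theorem exists_degree_ge_of_ne_one {m : ℕ} (hm : 2 ≤ m)
    {χ : Matrix.symplecticGroup (Fin (m + 1)) F → ℂ}
    (hχ : IsIrrChar (Matrix.symplecticGroup (Fin (m + 1)) F) χ) (hne : χ ≠ 1) :
    ∃ d : ℕ, χ 1 = d ∧ Fintype.card F ^ m - 1 ≤ d := by
  haveI : Nontrivial (Fin (m + 1)) := Fin.nontrivial_iff_two_le.mpr (by omega)
  have h3 : 3 ≤ Fintype.card (Fin (m + 1)) ∨ ∃ a : F, a ≠ 0 ∧ a ^ 2 ≠ 1 := Or.inl (by simp; omega)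
  obtain ⟨d, hd, hχd, h1⟩ :=
    exists_charDegree_of_ne_one_of_commutator_eq_top (commutator_eq_top h3) hχ hne
  exact ⟨d, hχd, le_charDegree_of_three_le hm hd h1⟩

/-- The same for `Sp(4, 𝔽_q)`, `q ≥ 4`: every irreducible `χ ≠ 1` has `q − 1 ≤ gcd(2, q − 1) · χ(1)`.
[cite: LandazuriSeitz1974, §1 (table, p. 419) and Lemma 3.1] -/
theorem exists_degree_ge_of_ne_one_two (hF : 4 ≤ Nat.card F)
    {χ : Matrix.symplecticGroup (Fin 2) F → ℂ}
    (hχ : IsIrrChar (Matrix.symplecticGroup (Fin 2) F) χ) (hne : χ ≠ 1) :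
    ∃ d : ℕ, χ 1 = d ∧ Fintype.card F - 1 ≤ Nat.gcd 2 (Fintype.card F - 1) * d := by
  have h3 : 3 ≤ Fintype.card (Fin 2) ∨ ∃ a : F, a ≠ 0 ∧ a ^ 2 ≠ 1 :=
    Or.inr (Literature.NumberTheory.GaloisRepresentations.exists_ne_zero_and_sq_ne_one_of_card hF)
  obtain ⟨d, hd, hχd, h1⟩ :=
    exists_charDegree_of_ne_one_of_commutator_eq_top (commutator_eq_top h3) hχ hne
  exact ⟨d, hχd, le_charDegree_two hd h1⟩

end Sp2n

end Literature.RepresentationTheory.FiniteGroups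

end
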